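import Mathlib.RingTheory.MvPolynomial.Symmetric.FundamentalTheorem
import Mathlib.RingTheory.MvPolynomial.Symmetric.NewtonIdentities
import Mathlib.RingTheory.MvPolynomial.Homogeneous
import Mathlib.RingTheory.MvPolynomial.WeightedHomogeneous
import Mathlib.Algebra.MvPolynomial.Monad
import Mathlib.Logic.Equiv.Prod
import Mathlib.Data.Fintype.Perm
import Mathlib.Algebra.BigOperators.Ring.Finset
import HarnessLib

/-!
# Block-symmetric polynomials and their fundamental theorem (with grading)

For a finite index type `T` ("blocks") and `n : ℕ`, the **block-symmetric** polynomials are the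
elements of `R[x_{τ,i} : τ ∈ T, i < n]` invariant under the Young subgroup `𝔖ₙ^T` permuting the
variables block-wise (`blockSymmetricSubalgebra T n R`); for `T` the real embeddings of
`𝕜 = ℝ, ℂ` into `ℂ` these are the Weyl group invariants `S(𝔥)^W` of `𝔤𝔩ₙ(ℂ)^T`
(`Literature.NumberTheory.Automorphic.symmetricSubalgebraGL`). Mathlib has the fundamental theorem of symmetric
polynomials for a single block (`MvPolynomial.esymmAlgEquiv`) but neither the block version nor a
degree-controlled version; this file proves what the Harish-Chandra isomorphism needs:

* `exists_blockEsymmAeval_eq_of_mem` / `range_blockEsymmAeval` (characteristic zero): every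
  block-symmetric polynomial is a polynomial in the block elementary symmetric polynomials
  `e_k(x_{τ,·})` (`Ψ_T = blockEsymmAeval` is onto the block-symmetric subalgebra) — by averaging
  with the block Reynolds operator, which on a monomial factors over the blocks
  (`blockReynolds_monomial`), and Mathlib's theorem in each block;
* `exists_isWeightedHomogeneous_blockEsymmAeval_eq`: a *homogeneous* block-symmetric polynomial
  of degree `d` is `Ψ_T(G)` with `G` *weighted homogeneous of weight `d`* for the weights
  `w(Y_{τ,k}) = k + 1` — by the general grading trick `homogeneousComponent_aeval`: `aeval φ`
  intertwines weighted homogeneous components and homogeneous components when `deg φ i = w i`.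

* `range_blockPsumAeval`, `exists_isWeightedHomogeneous_blockPsumAeval_eq` (characteristic
  zero): the same with the block **power sums** `p_k(x_{τ,·})`, `1 ≤ k ≤ n`, as generators, via
  Mathlib's Newton identity `MvPolynomial.mul_esymm_eq_sum` (`esymm_mem_adjoin_psum`). This is
  the form used for the Harish-Chandra isomorphism, whose central elements (traces of powers of
  the matrix of generators) have power sums as restricted top symbols.

## Main definitions

* `Literature.BlockSymmetric.blockSymmetricSubalgebra T n R`;
* `Literature.BlockSymmetric.bpsum R τ k`, `Literature.BlockSymmetric.blockPsumAeval T n R`;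
* `Literature.BlockSymmetric.besymm R τ k = e_k(x_{τ,0}, …, x_{τ,n-1})`;
* `Literature.BlockSymmetric.blockEsymmAeval T n R` (`Ψ_T`), `Literature.BlockSymmetric.blockWeight T n`;
* `Literature.BlockSymmetric.blockReynolds T n K` — averaging over `𝔖ₙ^T` (over a field of
  characteristic zero).

## References

* I. G. Macdonald, *Symmetric Functions and Hall Polynomials*, 2nd ed., OUP 1995, Ch. I §2
  ((2.4): `Λ = ℤ[e₁, e₂, …]`, graded).
* J. E. Humphreys, *Introduction to Lie Algebras and Representation Theory*, Springer 1972,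
  §23.1 (Chevalley's theorem for `𝔰𝔩ₙ`/`𝔤𝔩ₙ`: `S(𝔥)^W` = symmetric polynomials).
-/

noncomputable section

open MvPolynomial

namespace Literature.RingTheory.MvPolynomial.BlockSymmetric

/-! ### Weighted-homogeneous to homogeneous under `aeval` -/

section Grading

variable {ι σ R : Type*} [CommRing R]

/-- `aeval φ` of a monomial is homogeneous of degree its `w`-weight when each `φ i` is
homogeneous of degree `w i`. [folklore] -/
theorem isHomogeneous_aeval_monomial (w : ι → ℕ) (φ : ι → MvPolynomial σ R)
    (hφ : ∀ i, (φ i).IsHomogeneous (w i)) (s : ι →₀ ℕ) (c : R) :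
    (aeval φ (monomial s c)).IsHomogeneous (Finsupp.weight w s) := by
  rw [aeval_monomial, algebraMap_eq]
  refine IsHomogeneous.C_mul ?_ c
  rw [Finsupp.weight_apply, Finsupp.prod, Finsupp.sum]
  refine IsHomogeneous.prod _ _ _ fun i _ ↦ ?_
  rw [smul_eq_mul, mul_comm]
  exact (hφ i).pow (s i)

/-- If `φ i` is homogeneous of degree `w i`, then `aeval φ` sends the weighted homogeneous
component of weight `d` to the homogeneous component of degree `d`. [folklore] -/
theorem homogeneousComponent_aeval (w : ι → ℕ) (φ : ι → MvPolynomial σ R)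
    (hφ : ∀ i, (φ i).IsHomogeneous (w i)) (G : MvPolynomial ι R) (d : ℕ) :
    homogeneousComponent d (aeval φ G) = aeval φ (weightedHomogeneousComponent w d G) := by
  classical
  induction G using MvPolynomial.induction_on' with
  | monomial s c =>
    rw [homogeneousComponent_of_mem ((mem_homogeneousSubmodule _ _).mpr
        (isHomogeneous_aeval_monomial w φ hφ s c)),
      weightedHomogeneousComponent_of_mem ((mem_weightedHomogeneousSubmodule _ _ _ _).mpr
        (isWeightedHomogeneous_monomial w s c rfl))]
    split_ifs with h
    · rfl
    · rw [map_zero]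
  | add p q hp hq => simp only [map_add, hp, hq]

/-- **Grading trick.** If `φ i` is homogeneous of degree `w i` and `f = aeval φ G` is homogeneous
of degree `d`, then `f = aeval φ G'` with `G'` weighted homogeneous of weight `d` (namely the
weight-`d` component of `G`). [folklore] -/
theorem exists_isWeightedHomogeneous_of_isHomogeneous_aeval (w : ι → ℕ)
    (φ : ι → MvPolynomial σ R) (hφ : ∀ i, (φ i).IsHomogeneous (w i)) (G : MvPolynomial ι R)
    {d : ℕ} (hG : (aeval φ G).IsHomogeneous d) :
    ∃ G' : MvPolynomial ι R, IsWeightedHomogeneous w G' d ∧ aeval φ G' = aeval φ G := by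
  refine ⟨weightedHomogeneousComponent w d G, weightedHomogeneousComponent_isWeightedHomogeneous d G,
    ?_⟩
  rw [← homogeneousComponent_aeval w φ hφ G d, homogeneousComponent_eq_self hG]

end Grading

/-! ### Block-symmetric polynomials and block elementary symmetric polynomials -/

section Block

variable (T : Type*) (n : ℕ) (R : Type*) [CommRing R]

/-- The subalgebra `R[x_{τ,i}]^{∏_{τ ∈ T} 𝔖ₙ}` of polynomials in the variables `x_{τ,i}`
(`τ : T`, `i : Fin n`) invariant under all *block-wise* permutations `(τ, i) ↦ (τ, σ_τ i)`.
For `T` the set of real embeddings of `𝕜 = ℝ, ℂ` into `ℂ` these are the Weyl group invariants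
`S(𝔥)^W` for `𝔤𝔩ₙ(ℂ)^T` (`Literature.NumberTheory.Automorphic.symmetricSubalgebraGL`). Mathlib's
`MvPolynomial.symmetricSubalgebra` is the case of a single block. [folklore] -/
def blockSymmetricSubalgebra : Subalgebra R (MvPolynomial (T × Fin n) R) where
  carrier := {p | ∀ σ : T → Equiv.Perm (Fin n), rename (Equiv.prodCongrRight σ) p = p}
  mul_mem' {p q} hp hq σ := by rw [map_mul, hp σ, hq σ]
  add_mem' {p q} hp hq σ := by rw [map_add, hp σ, hq σ]
  algebraMap_mem' c σ := AlgHom.commutes _ c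

variable {T n R} in
/-- Membership in `blockSymmetricSubalgebra`. [folklore] -/
theorem mem_blockSymmetricSubalgebra_iff (p : MvPolynomial (T × Fin n) R) :
    p ∈ blockSymmetricSubalgebra T n R ↔
      ∀ σ : T → Equiv.Perm (Fin n), rename (Equiv.prodCongrRight σ) p = p :=
  Iff.rfl

variable {T n R} in
/-- Homogeneous components of block-symmetric polynomials are block-symmetric. [folklore] -/
theorem homogeneousComponent_mem_blockSymmetricSubalgebra {p : MvPolynomial (T × Fin n) R}
    (hp : p ∈ blockSymmetricSubalgebra T n R) (d : ℕ) :
    homogeneousComponent d p ∈ blockSymmetricSubalgebra T n R := fun σ ↦ by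
  rw [rename_homogeneousComponent, hp σ]

variable {T n} in
/-- The elementary symmetric polynomial `e_k` in the variables of block `τ`. [folklore] -/
def besymm (τ : T) (k : ℕ) : MvPolynomial (T × Fin n) R :=
  rename (Prod.mk τ) (esymm (Fin n) R k)

variable {T n R} in
/-- Block elementary symmetric polynomials are block-symmetric. [folklore] -/
theorem besymm_mem (τ : T) (k : ℕ) : besymm R τ k ∈ blockSymmetricSubalgebra T n R := fun σ ↦ by
  rw [besymm, rename_rename]
  have : (Equiv.prodCongrRight σ) ∘ Prod.mk τ = (Prod.mk τ : Fin n → T × Fin n) ∘ (σ τ) := rfl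
  rw [this, ← rename_rename, rename_esymm]

variable {T n R} in
/-- `e_k` in block `τ` is homogeneous of degree `k`. [folklore] -/
theorem besymm_isHomogeneous (τ : T) (k : ℕ) : (besymm (n := n) R τ k).IsHomogeneous k := by
  rw [besymm]
  refine IsHomogeneous.rename_isHomogeneous ?_
  rw [esymm_eq_sum_monomial]
  refine IsHomogeneous.sum _ _ _ fun t ht ↦ isHomogeneous_monomial _ ?_
  rw [Finset.mem_powersetCard] at ht
  rw [Finsupp.degree_apply]
  classical
  have hsupp : (∑ i ∈ t, Finsupp.single i 1 : Fin n →₀ ℕ).support = t := by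
    ext i
    simp [Finsupp.mem_support_iff, Finsupp.finsetSum_apply, Finsupp.single_apply,
      Finset.sum_ite_eq']
  rw [hsupp, ← ht.2]
  rw [Finset.card_eq_sum_ones]
  refine Finset.sum_congr rfl fun i hi ↦ ?_
  simp [Finsupp.finsetSum_apply, Finsupp.single_apply, Finset.sum_ite_eq', hi]

/-- The block elementary symmetric algebra homomorphism
`Ψ_T : R[Y_{τ,k} : τ ∈ T, k < n] → R[x_{τ,i}]`, `Y_{τ,k} ↦ e_{k+1}(x_{τ,·})`. [folklore] -/
def blockEsymmAeval : MvPolynomial (T × Fin n) R →ₐ[R] MvPolynomial (T × Fin n) R :=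
  aeval fun p : T × Fin n ↦ besymm R p.1 (p.2 + 1)

/-- The weights `w(τ, k) = k + 1` making `Ψ_T` degree-preserving. [folklore] -/
def blockWeight : T × Fin n → ℕ := fun p ↦ p.2 + 1

variable {T n R} in
/-- `Ψ_T` takes values in the block-symmetric polynomials. [folklore] -/
theorem blockEsymmAeval_mem (G : MvPolynomial (T × Fin n) R) :
    blockEsymmAeval T n R G ∈ blockSymmetricSubalgebra T n R := by
  have : (blockEsymmAeval T n R).range ≤ blockSymmetricSubalgebra T n R := by
    rw [blockEsymmAeval, aeval_range, Algebra.adjoin_le_iff]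
    rintro _ ⟨p, rfl⟩
    exact besymm_mem _ _
  exact this ⟨G, rfl⟩

variable {T n R} in
/-- `Ψ_T` maps weighted homogeneous polynomials of weight `d` to homogeneous polynomials of
degree `d`. [folklore] -/
theorem isHomogeneous_blockEsymmAeval {G : MvPolynomial (T × Fin n) R} {d : ℕ}
    (hG : IsWeightedHomogeneous (blockWeight T n) G d) :
    (blockEsymmAeval T n R G).IsHomogeneous d := by
  classical
  have h := homogeneousComponent_aeval (blockWeight T n)
    (fun p : T × Fin n ↦ (besymm R p.1 (p.2 + 1) : MvPolynomial (T × Fin n) R))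
    (fun p ↦ besymm_isHomogeneous p.1 _) G d
  rw [weightedHomogeneousComponent_of_mem ((mem_weightedHomogeneousSubmodule _ _ _ _).mpr hG),
    if_pos rfl] at h
  rw [blockEsymmAeval, ← h]
  exact homogeneousComponent_isHomogeneous d _

end Block

/-! ### The block Reynolds operator and the fundamental theorem for blocks -/

section Reynolds

variable {T : Type*} [Fintype T] [DecidableEq T] {n : ℕ} {K : Type*} [Field K]

variable (T n K) in
/-- The block Reynolds operator: averaging over the finite group `𝔖ₙ^T` of block-wise
permutations. [folklore] -/
def blockReynolds : MvPolynomial (T × Fin n) K →ₗ[K] MvPolynomial (T × Fin n) K :=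
  ((Fintype.card (T → Equiv.Perm (Fin n)) : K)⁻¹) •
    ∑ σ : T → Equiv.Perm (Fin n), (rename (Equiv.prodCongrRight σ)).toLinearMap

/-- Unfolding the Reynolds operator. [folklore] -/
theorem blockReynolds_apply (f : MvPolynomial (T × Fin n) K) :
    blockReynolds T n K f = ((Fintype.card (T → Equiv.Perm (Fin n)) : K)⁻¹) •
      ∑ σ : T → Equiv.Perm (Fin n), rename (Equiv.prodCongrRight σ) f := by
  simp [blockReynolds, LinearMap.sum_apply]

/-- The Reynolds operator fixes block-symmetric polynomials. [folklore] -/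
theorem blockReynolds_of_mem [CharZero K] {f : MvPolynomial (T × Fin n) K}
    (hf : f ∈ blockSymmetricSubalgebra T n K) : blockReynolds T n K f = f := by
  rw [blockReynolds_apply, Finset.sum_congr rfl fun σ _ ↦ hf σ, Finset.sum_const, Finset.card_univ,
    ← Nat.cast_smul_eq_nsmul K, smul_smul, inv_mul_cancel₀, one_smul]
  exact Nat.cast_ne_zero.mpr Fintype.card_ne_zero

omit [DecidableEq T] in
/-- A monomial in the variables `x_{τ,i}` is the product over `τ` of its block parts. [folklore] -/
theorem monomial_eq_prod_rename_curry (s : T × Fin n →₀ ℕ) :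
    (monomial s (1 : K)) = ∏ τ, rename (Prod.mk τ) (monomial (s.curry τ) (1 : K)) := by
  have h1 : ∀ τ, rename (Prod.mk τ) (monomial (s.curry τ) (1 : K)) =
      ∏ i : Fin n, (X (τ, i) : MvPolynomial (T × Fin n) K) ^ s (τ, i) := by
    intro τ
    rw [monomial_eq, C_1, one_mul, Finsupp.prod_fintype _ _ fun _ ↦ pow_zero _, map_prod]
    simp only [map_pow, rename_X, Finsupp.curry_apply]
  simp_rw [h1]
  rw [monomial_eq, C_1, one_mul, Finsupp.prod_fintype _ _ fun _ ↦ pow_zero _,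
    Fintype.prod_prod_type]

/-- The symmetrization `∑_{π ∈ 𝔖ₙ} π · x^t` of a monomial in one block. [folklore] -/
def symmPart (t : Fin n →₀ ℕ) : MvPolynomial (Fin n) K :=
  ∑ π : Equiv.Perm (Fin n), rename π (monomial t (1 : K))

omit [Fintype T] [DecidableEq T] in
/-- `symmPart t` is a symmetric polynomial. [folklore] -/
theorem symmPart_mem (t : Fin n →₀ ℕ) : symmPart (K := K) t ∈ symmetricSubalgebra (Fin n) K := by
  rw [mem_symmetricSubalgebra]
  intro π'
  rw [symmPart, map_sum]
  simp_rw [rename_rename]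
  exact Fintype.sum_equiv (Equiv.mulLeft π') _ _ fun π ↦ rfl

omit [DecidableEq T] in
/-- A block-wise permutation acts on a monomial block by block. [folklore] -/
theorem rename_prodCongrRight_monomial (σ : T → Equiv.Perm (Fin n)) (s : T × Fin n →₀ ℕ) :
    rename (Equiv.prodCongrRight σ) (monomial s (1 : K)) =
      ∏ τ, rename (Prod.mk τ) (rename (σ τ) (monomial (s.curry τ) (1 : K))) := by
  rw [monomial_eq_prod_rename_curry, map_prod]
  refine Finset.prod_congr rfl fun τ _ ↦ ?_
  rw [rename_rename, rename_rename]
  rfl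

/-- **The Reynolds operator on a monomial** is a product over the blocks of symmetrized block
monomials: `R(x^s) = |𝔖ₙ^T|⁻¹ ∏_τ ∑_{π} π · x_τ^{s_τ}`. [folklore] -/
theorem blockReynolds_monomial (s : T × Fin n →₀ ℕ) :
    blockReynolds T n K (monomial s 1) = ((Fintype.card (T → Equiv.Perm (Fin n)) : K)⁻¹) •
      ∏ τ, rename (Prod.mk τ) (symmPart (K := K) (s.curry τ)) := by
  rw [blockReynolds_apply]
  congr 1
  simp_rw [rename_prodCongrRight_monomial, symmPart, map_sum]
  exact (Fintype.prod_sum fun τ (π : Equiv.Perm (Fin n)) ↦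
    rename (Prod.mk τ) (rename π (monomial (s.curry τ) (1 : K)))).symm

omit [Fintype T] [DecidableEq T] in
/-- `rename (Prod.mk τ)` of a symmetric polynomial in `n` variables lies in the range of `Ψ_T`
(Mathlib's fundamental theorem of symmetric polynomials, block by block). [folklore] -/
theorem rename_mk_mem_range_of_mem_symmetricSubalgebra (τ : T) {g : MvPolynomial (Fin n) K}
    (hg : g ∈ symmetricSubalgebra (Fin n) K) :
    rename (Prod.mk τ) g ∈ (blockEsymmAeval T n K).range := by
  obtain ⟨G, hG⟩ := esymmAlgHom_surjective K (σ := Fin n) (n := n) (by simp) ⟨g, hg⟩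
  have hG' : aeval (fun i : Fin n ↦ esymm (Fin n) K (i + 1)) G = g := by
    rw [← esymmAlgHom_apply, hG]
  have key : blockEsymmAeval T n K (rename (fun k : Fin n ↦ (τ, k)) G) = rename (Prod.mk τ) g := by
    rw [blockEsymmAeval, aeval_rename, ← hG']
    change _ = (rename (Prod.mk τ)).comp (aeval fun i : Fin n ↦ esymm (Fin n) K (i + 1)) G
    congr 1
    refine MvPolynomial.algHom_ext fun i ↦ ?_
    simp [besymm]
  exact ⟨_, key⟩

/-- The Reynolds operator takes values in the range of `Ψ_T`. [folklore] -/
theorem blockReynolds_mem_range (f : MvPolynomial (T × Fin n) K) :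
    blockReynolds T n K f ∈ Subalgebra.toSubmodule (blockEsymmAeval T n K).range := by
  rw [← f.support_sum_monomial_coeff, map_sum]
  refine Submodule.sum_mem _ fun s _ ↦ ?_
  rw [← mul_one (coeff s f), ← smul_eq_mul, ← smul_monomial, map_smul]
  refine Submodule.smul_mem _ _ ?_
  rw [blockReynolds_monomial]
  refine Submodule.smul_mem _ _ ?_
  rw [Subalgebra.mem_toSubmodule]
  exact Subalgebra.prod_mem _ fun τ _ ↦
    rename_mk_mem_range_of_mem_symmetricSubalgebra τ (symmPart_mem _)

/-- **Fundamental theorem of block-symmetric polynomials** (characteristic zero): every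
block-symmetric polynomial is a polynomial in the block elementary symmetric polynomials
`e_k(x_{τ,·})`, `1 ≤ k ≤ n`. [folklore] -/
theorem exists_blockEsymmAeval_eq_of_mem [CharZero K] {f : MvPolynomial (T × Fin n) K}
    (hf : f ∈ blockSymmetricSubalgebra T n K) : ∃ G, blockEsymmAeval T n K G = f := by
  have h := blockReynolds_mem_range f
  rw [blockReynolds_of_mem hf] at h
  exact h

/-- The range of `Ψ_T` is exactly the block-symmetric subalgebra (characteristic zero). [folklore] -/
theorem range_blockEsymmAeval [CharZero K] :
    (blockEsymmAeval T n K).range = blockSymmetricSubalgebra T n K :=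
  le_antisymm (fun _ ⟨G, hG⟩ ↦ hG ▸ blockEsymmAeval_mem G)
    fun _ hf ↦ exists_blockEsymmAeval_eq_of_mem hf

/-- **Graded fundamental theorem of block-symmetric polynomials**: a homogeneous block-symmetric
polynomial of degree `d` is `Ψ_T(G)` for a polynomial `G` in the `Y_{τ,k}` which is weighted
homogeneous of weight `d` for the weights `w(Y_{τ,k}) = k + 1 = deg e_{k+1}`. [folklore] -/
theorem exists_isWeightedHomogeneous_blockEsymmAeval_eq [CharZero K] {f : MvPolynomial (T × Fin n) K}
    (hf : f ∈ blockSymmetricSubalgebra T n K) {d : ℕ} (hd : f.IsHomogeneous d) :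
    ∃ G, IsWeightedHomogeneous (blockWeight T n) G d ∧ blockEsymmAeval T n K G = f := by
  obtain ⟨G₀, rfl⟩ := exists_blockEsymmAeval_eq_of_mem hf
  exact exists_isWeightedHomogeneous_of_isHomogeneous_aeval (blockWeight T n) _
    (fun p ↦ besymm_isHomogeneous p.1 _) G₀ hd

end Reynolds

/-! ### Power sums as generators (Newton's identities) -/

section PowerSums

variable (T : Type*) (n : ℕ) (R : Type*) [CommRing R]

variable {T n} in
/-- The power sum `p_k = ∑_i x_{τ,i}^k` in the variables of block `τ`. [folklore] -/
def bpsum (τ : T) (k : ℕ) : MvPolynomial (T × Fin n) R :=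
  rename (Prod.mk τ) (psum (Fin n) R k)

variable {T n R} in
/-- Block power sums are block-symmetric. [folklore] -/
theorem bpsum_mem (τ : T) (k : ℕ) : bpsum R τ k ∈ blockSymmetricSubalgebra T n R := fun σ ↦ by
  rw [bpsum, rename_rename]
  have : (Equiv.prodCongrRight σ) ∘ Prod.mk τ = (Prod.mk τ : Fin n → T × Fin n) ∘ (σ τ) := rfl
  rw [this, ← rename_rename, rename_psum]

variable {T n R} in
/-- `p_k` in block `τ` is homogeneous of degree `k`. [folklore] -/
theorem bpsum_isHomogeneous (τ : T) (k : ℕ) : (bpsum (n := n) R τ k).IsHomogeneous k := by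
  rw [bpsum, psum]
  refine IsHomogeneous.rename_isHomogeneous (IsHomogeneous.sum _ _ _ fun i _ ↦ ?_)
  exact isHomogeneous_X_pow _ _

/-- The block power-sum algebra homomorphism `R[Y_{τ,k}] → R[x_{τ,i}]`, `Y_{τ,k} ↦ p_{k+1}(x_{τ,·})`.
[folklore] -/
def blockPsumAeval : MvPolynomial (T × Fin n) R →ₐ[R] MvPolynomial (T × Fin n) R :=
  aeval fun p : T × Fin n ↦ bpsum R p.1 (p.2 + 1)

variable {T n R} in
/-- The block power-sum map takes values in the block-symmetric polynomials. [folklore] -/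
theorem blockPsumAeval_mem (G : MvPolynomial (T × Fin n) R) :
    blockPsumAeval T n R G ∈ blockSymmetricSubalgebra T n R := by
  have : (blockPsumAeval T n R).range ≤ blockSymmetricSubalgebra T n R := by
    rw [blockPsumAeval, aeval_range, Algebra.adjoin_le_iff]
    rintro _ ⟨p, rfl⟩
    exact bpsum_mem _ _
  exact this ⟨G, rfl⟩

variable {T n R} in
/-- The block power-sum map sends weighted homogeneous polynomials of weight `d` to homogeneous
polynomials of degree `d`. [folklore] -/
theorem isHomogeneous_blockPsumAeval {G : MvPolynomial (T × Fin n) R} {d : ℕ}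
    (hG : IsWeightedHomogeneous (blockWeight T n) G d) :
    (blockPsumAeval T n R G).IsHomogeneous d := by
  classical
  have h := homogeneousComponent_aeval (blockWeight T n)
    (fun p : T × Fin n ↦ (bpsum R p.1 (p.2 + 1) : MvPolynomial (T × Fin n) R))
    (fun p ↦ bpsum_isHomogeneous p.1 _) G d
  rw [weightedHomogeneousComponent_of_mem ((mem_weightedHomogeneousSubmodule _ _ _ _).mpr hG),
    if_pos rfl] at h
  rw [blockPsumAeval, ← h]
  exact homogeneousComponent_isHomogeneous d _

variable {K : Type*} [Field K] [CharZero K]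

/-- **Newton**: over a field of characteristic zero the elementary symmetric polynomials `e_k`,
`k ≤ n`, are polynomials in the power sums `p_1, …, p_n` (from Mathlib's Newton identity
`MvPolynomial.mul_esymm_eq_sum`, dividing by `k`). [folklore] -/
theorem esymm_mem_adjoin_psum {k : ℕ} (hk : k ≤ n) :
    esymm (Fin n) K k ∈ Algebra.adjoin K (Set.range fun i : Fin n ↦ psum (Fin n) K (i + 1)) := by
  induction k using Nat.strong_induction_on with
  | _ k ih =>
    rcases Nat.eq_zero_or_pos k with rfl | hpos
    · rw [esymm_zero]
      exact Subalgebra.one_mem _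
    have hk0 : (k : K) ≠ 0 := Nat.cast_ne_zero.mpr hpos.ne'
    have key := MvPolynomial.mul_esymm_eq_sum (Fin n) K k
    have : esymm (Fin n) K k = C (k : K)⁻¹ * ((k : MvPolynomial (Fin n) K) * esymm (Fin n) K k) := by
      rw [← mul_assoc, show (k : MvPolynomial (Fin n) K) = C (k : K) from (map_natCast C k).symm,
        ← map_mul, inv_mul_cancel₀ hk0, C_1, one_mul]
    rw [this, key]
    refine Subalgebra.mul_mem _ (Subalgebra.algebraMap_mem _ _) (Subalgebra.mul_mem _ ?_ ?_)
    · exact Subalgebra.pow_mem _ (Subalgebra.neg_mem _ (Subalgebra.one_mem _)) _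
    refine Subalgebra.sum_mem _ fun a ha ↦ ?_
    rw [Finset.mem_filter, Finset.mem_antidiagonal] at ha
    refine Subalgebra.mul_mem _ (Subalgebra.mul_mem _ (Subalgebra.pow_mem _
      (Subalgebra.neg_mem _ (Subalgebra.one_mem _)) _) (ih a.1 ha.2 (by omega))) ?_
    have ha2 : 1 ≤ a.2 ∧ a.2 ≤ n := by omega
    refine Algebra.subset_adjoin ⟨⟨a.2 - 1, by omega⟩, ?_⟩
    simp only
    rw [Nat.sub_add_cancel ha2.1]

variable {T n} in
/-- Block elementary symmetric polynomials are polynomials in the block power sums. [folklore] -/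
theorem besymm_mem_range_blockPsumAeval [DecidableEq T] (τ : T) (k : Fin n) :
    besymm K τ (k + 1) ∈ (blockPsumAeval T n K).range := by
  have h := esymm_mem_adjoin_psum (n := n) (K := K) (k := k + 1) (by omega)
  have hle : Algebra.adjoin K (Set.range fun i : Fin n ↦ psum (Fin n) K (i + 1)) ≤
      ((blockPsumAeval T n K).range).comap (rename (Prod.mk τ)) := by
    refine Algebra.adjoin_le ?_
    rintro _ ⟨i, rfl⟩
    have : blockPsumAeval T n K (X (τ, i)) = rename (Prod.mk τ) (psum (Fin n) K (i + 1)) := by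
      rw [blockPsumAeval, aeval_X]
      rfl
    exact ⟨X (τ, i), this⟩
  exact hle h

/-- Over a field of characteristic zero, `Ψ_T` (elementary) factors through the power-sum map:
its range is contained in that of `blockPsumAeval`. [folklore] -/
theorem range_blockEsymmAeval_le [DecidableEq T] :
    (blockEsymmAeval T n K).range ≤ (blockPsumAeval T n K).range := by
  rw [blockEsymmAeval, aeval_range, Algebra.adjoin_le_iff]
  rintro _ ⟨⟨τ, k⟩, rfl⟩
  exact besymm_mem_range_blockPsumAeval τ k

/-- **Fundamental theorem of block-symmetric polynomials, power-sum form** (characteristic zero):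
the block power sums `p_k(x_{τ,·})`, `1 ≤ k ≤ n`, generate the block-symmetric polynomials. [folklore] -/
theorem range_blockPsumAeval [Fintype T] [DecidableEq T] :
    (blockPsumAeval T n K).range = blockSymmetricSubalgebra T n K := by
  refine le_antisymm (fun _ ⟨G, hG⟩ ↦ hG ▸ blockPsumAeval_mem G) ?_
  rw [← range_blockEsymmAeval]
  exact range_blockEsymmAeval_le T n

/-- **Graded fundamental theorem, power-sum form**: a homogeneous block-symmetric polynomial of
degree `d` is `blockPsumAeval G` with `G` weighted homogeneous of weight `d`
(`w(Y_{τ,k}) = k + 1 = deg p_{k+1}`). [folklore] -/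
theorem exists_isWeightedHomogeneous_blockPsumAeval_eq [Fintype T] [DecidableEq T]
    {f : MvPolynomial (T × Fin n) K} (hf : f ∈ blockSymmetricSubalgebra T n K) {d : ℕ}
    (hd : f.IsHomogeneous d) :
    ∃ G, IsWeightedHomogeneous (blockWeight T n) G d ∧ blockPsumAeval T n K G = f := by
  rw [← range_blockPsumAeval] at hf
  obtain ⟨G₀, rfl⟩ := hf
  exact exists_isWeightedHomogeneous_of_isHomogeneous_aeval (blockWeight T n) _
    (fun p ↦ bpsum_isHomogeneous p.1 _) G₀ hd

end PowerSums

end Literature.RingTheory.MvPolynomial.BlockSymmetric
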